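import Summits.HodgeConjecture.CorCM.Census.DicyclicTwistFunctionals

/-!
# The dicyclic twist `Dic(A) ⊃ ℤ/2 × A`, V: normalisation and the key lemma on the residual labels

COR-CM (cell `pub-hodgecm2`, stage 2 of the Hodge ladder), count-neutral KERNEL COMBINATORICS by the binder seat b23 (gen 42; claim
DICYCLIC-COLUMN, HOME/INBOX.md l.10328): part V of the lane `DicyclicTwistModel` → … → `DicyclicTwistCount`.  Bookkeeping definition with
body (`nrm₂`) + theorems on top of parts I–IV; no `decide` table, no certificate, no named fact, no geometry, no `sorry`.  `Interfaces.lean`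
(C1), every E term, B01, `Transposition/*`, `PortJoin/*` untouched.
HONEST FRAMING: `HC_CM` is NOT proved, here or anywhere in the tree; nothing here is a period, a count of record or a headline.

CONTENT (`|A|` odd, `≥ 3`).  §1 NORMALISATION modulo pairs by the half of the `0`-coordinate (b09's `nrm` on `ψ₀`): `nrm₂ r` is supported on
labels with `ψ₀` in the lower half, `r − nrm₂ r ∈ P₂`, and the potential of the support does not grow.  §2 The NORMAL RESIDUAL LABELS
(potential `≤ 1`, `ψ₀` low) are `(0, 0)`, `(0, 1)`, `(0, δ t)`, `(0, 1 + δ t)`, `(δ s, 0)`, `(δ s, 1)` (`normal_cases`); on a vector `r` supported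
there the functionals of part IV read single coefficients or coefficient sums (`U_s r = r(0, 1+δ s)`, `U'_s r = −r(δ s, 1)`,
`C₁ r = Σ_t (r(0,δ t) − r(0,1+δ t))`, `C₀ r = Σ_s (r(δ s,0) + r(δ s,1))`), and the Pohlmann forms of the two marginals read
`Σ − 2·(t-th coefficient)` sums (§3).  §4 THE KEY LEMMA: **a Hodge vector supported on the normal residual labels with
`U = U' = 0`, `C₀ = C₁ = 0` is zero** (`eq_zero_of_residual`), and on every such Hodge vector `C₀`, `C₁` are multiples of `|A|`
(`card_dvd_C₀`, `card_dvd_C₁`) — so (part VI) a Hodge vector on the residual labels is determined modulo pairs by its `2|A| + 2` functional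
values, which range over `ℤ^A ⊕ |A|ℤ ⊕ ℤ^A ⊕ |A|ℤ`.  All [folklore].

## References
* [Pohlmann1968] H. Pohlmann, Algebraic cycles on abelian varieties of complex multiplication type, Ann. of Math. 88 (1968), Thm 1.
-/

namespace Summit.HodgeConjecture.CorCM.Census.DicyclicTwist

open Finset
open Summit.HodgeConjecture.CorCM.Census.OddSliceFacesModel
open Summit.HodgeConjecture.CorCM.Census.OddSliceFacesSquares
open Summit.HodgeConjecture.CorCM.Census.OddSliceFacesDescent
open Summit.HodgeConjecture.CorCM.Census.EvenSliceFacesDescent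
open Summit.HodgeConjecture.CorCM.Census.OddSliceFacesGenerate

variable (A : Type) [AddCommGroup A] [Fintype A] [DecidableEq A]

/-! ## §1 Normalisation by the half of the `0`-coordinate -/

/-- Move every coefficient onto the member of its conjugate pair whose `0`-coordinate is in the lower half. [folklore] -/
def nrm₂ (r : Ty₂ A → ℤ) : Ty₂ A → ℤ := fun Ψ => if (wt A Ψ.1 ≤ Fintype.card A / 2) then r Ψ - r (conj A Ψ) else 0

omit [DecidableEq A] [AddCommGroup A] in
/-- `nrm₂ r` is supported on labels with low `0`-coordinate. [folklore] -/
theorem isLow_of_nrm₂_ne_zero (r : Ty₂ A → ℤ) {Ψ : Ty₂ A} (h : nrm₂ A r Ψ ≠ 0) : (wt A Ψ.1 ≤ Fintype.card A / 2) := by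
  by_contra hc; exact h (by simp [nrm₂, hc])

omit [AddCommGroup A] [DecidableEq A] in
/-- The support of `nrm₂ r` lies in the support of `r` and its conjugate. [folklore] -/
theorem nrm₂_ne_zero (r : Ty₂ A → ℤ) {Ψ : Ty₂ A} (h : nrm₂ A r Ψ ≠ 0) : r Ψ ≠ 0 ∨ r (conj A Ψ) ≠ 0 := by
  by_contra hc
  simp only [not_or, not_not] at hc
  exact h (by simp [nrm₂, hc.1, hc.2])

omit [Fintype A] [DecidableEq A] [AddCommGroup A] in
/-- Conjugation is an involution. [folklore] -/
theorem conj_conj (Ψ : Ty₂ A) : conj A (conj A Ψ) = Ψ := by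
  obtain ⟨a, b⟩ := Ψ; simp only [conj, add_one_add_one]

omit [AddCommGroup A] in
/-- `r − nrm₂ r` is the sum of the pairs through the labels with upper `0`-coordinate (`|A|` odd). [folklore] -/
theorem sub_nrm₂_eq (hA : Odd (Fintype.card A)) (r : Ty₂ A → ℤ) :
    r - nrm₂ A r = ∑ Ψ ∈ univ.filter (fun Ψ : Ty₂ A => ¬ (wt A Ψ.1 ≤ Fintype.card A / 2)), r Ψ • pairVec₂ A Ψ := by
  funext χ
  rw [Pi.sub_apply, Finset.sum_apply]
  have hterm : ∀ Ψ ∈ univ.filter (fun Ψ : Ty₂ A => ¬ (wt A Ψ.1 ≤ Fintype.card A / 2)), (r Ψ • pairVec₂ A Ψ) χ =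
      (if χ = Ψ then r Ψ else 0) + (if conj A χ = Ψ then r Ψ else 0) := by
    intro Ψ _
    have hc : (χ = conj A Ψ) ↔ (conj A χ = Ψ) := by
      constructor
      · intro h; rw [h, conj_conj]
      · intro h; rw [← h, conj_conj]
    simp only [pairVec₂, Pi.smul_apply, Pi.add_apply, smul_eq_mul, Pi.single_apply, hc]
    split_ifs <;> ring
  rw [Finset.sum_congr rfl hterm, Finset.sum_add_distrib, Finset.sum_ite_eq, Finset.sum_ite_eq]
  simp only [Finset.mem_filter, Finset.mem_univ, true_and, nrm₂]
  have hconj : wt A (conj A χ).1 ≤ Fintype.card A / 2 ↔ ¬ wt A χ.1 ≤ Fintype.card A / 2 := by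
    show wt A (χ.1 + 1) ≤ Fintype.card A / 2 ↔ ¬ wt A χ.1 ≤ Fintype.card A / 2
    exact ⟨fun h hl => not_wt_add_one_le A hA hl h, wt_add_one_le A hA⟩
  by_cases hχ : (wt A χ.1 ≤ Fintype.card A / 2)
  · rw [if_pos hχ, if_neg (fun h => h hχ), if_pos (fun h => (hconj.mp h) hχ)]; ring
  · rw [if_neg hχ, if_pos hχ, if_neg (fun h => h (hconj.mpr hχ))]; ring

omit [AddCommGroup A] in
/-- **`r − nrm₂ r ∈ P₂`.** [folklore] -/
theorem sub_nrm₂_mem (hA : Odd (Fintype.card A)) (r : Ty₂ A → ℤ) : r - nrm₂ A r ∈ pairs₂ A := by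
  rw [sub_nrm₂_eq A hA]
  exact Submodule.sum_mem _ fun Ψ _ => Submodule.smul_mem _ _ (Submodule.subset_span ⟨Ψ, rfl⟩)

/-! ## §2 The normal residual labels -/

omit [AddCommGroup A] in
/-- A type of class `0` is constant. [folklore] -/
theorem eq_zero_or_one_of_clsTy_eq_zero {b : Ty A} (h : clsTy A b = 0) : b = 0 ∨ b = 1 := by
  have hw := wt_le A b
  unfold clsTy at h
  rcases Nat.le_total (wt A b) (Fintype.card A - wt A b) with hle | hle
  · rw [min_eq_left hle] at h
    rcases eq_zero_or_eq_delta_of_wt_le_one A (χ := b) (by omega) with h0 | ⟨s, hs⟩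
    · exact Or.inl h0
    · rw [hs, wt_delta] at h; omega
  · rw [min_eq_right hle] at h
    have h1 : wt A (b + 1) ≤ 1 := by rw [wt_add_one]; omega
    rcases eq_zero_or_eq_delta_of_wt_le_one A h1 with h0 | ⟨s, hs⟩
    · right; have := congrArg (· + (1 : Ty A)) h0; simpa [add_one_add_one] using this
    · have := congrArg (wt A) hs; rw [wt_delta, wt_add_one] at this; omega

omit [AddCommGroup A] in
/-- A low type of class `≤ 1` is `0` or a unit type. [folklore] -/
theorem low_cases {a : Ty A} (hl : (wt A a ≤ Fintype.card A / 2)) (h : clsTy A a ≤ 1) : a = 0 ∨ ∃ s, a = δ A s := by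
  unfold clsTy at h
  have hw := wt_le A a
  exact eq_zero_or_eq_delta_of_wt_le_one A (χ := a) (by omega)

omit [AddCommGroup A] in
/-- A type of class `≤ 1` is `0`, `1`, a unit type or the conjugate of a unit type. [folklore] -/
theorem cls_le_one_cases {b : Ty A} (h : clsTy A b ≤ 1) : b = 0 ∨ b = 1 ∨ ∃ t, b = δ A t ∨ b = 1 + δ A t := by
  have hw := wt_le A b
  unfold clsTy at h
  rcases Nat.le_total (wt A b) (Fintype.card A - wt A b) with hle | hle
  · rw [min_eq_left hle] at h
    rcases eq_zero_or_eq_delta_of_wt_le_one A (χ := b) h with h0 | ⟨s, hs⟩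
    · exact Or.inl h0
    · exact Or.inr (Or.inr ⟨s, Or.inl hs⟩)
  · rw [min_eq_right hle] at h
    have h1 : wt A (b + 1) ≤ 1 := by rw [wt_add_one]; omega
    rcases eq_zero_or_eq_delta_of_wt_le_one A h1 with h0 | ⟨s, hs⟩
    · right; left; have := congrArg (· + (1 : Ty A)) h0; simpa [add_one_add_one] using this
    · right; right; refine ⟨s, Or.inr ?_⟩
      calc b = b + 1 + 1 := (add_one_add_one A b).symm
        _ = δ A s + 1 := by rw [hs]
        _ = 1 + δ A s := add_comm _ _

omit [AddCommGroup A] in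
/-- **The normal residual labels**: potential `≤ 1` and low `0`-coordinate forces one of six shapes. [folklore] -/
theorem normal_cases {Ψ : Ty₂ A} (hp : pot A Ψ ≤ 1) (hl : (wt A Ψ.1 ≤ Fintype.card A / 2)) :
    (Ψ.1 = 0 ∧ (Ψ.2 = 0 ∨ Ψ.2 = 1 ∨ ∃ t, Ψ.2 = δ A t ∨ Ψ.2 = 1 + δ A t)) ∨ (∃ s, Ψ.1 = δ A s ∧ (Ψ.2 = 0 ∨ Ψ.2 = 1)) := by
  unfold pot at hp
  rcases low_cases A hl (by omega) with h0 | ⟨s, hs⟩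
  · exact Or.inl ⟨h0, cls_le_one_cases A (by omega)⟩
  · right
    refine ⟨s, hs, eq_zero_or_one_of_clsTy_eq_zero A ?_⟩
    have h1 : clsTy A Ψ.1 = 1 := by
      rw [hs]; unfold clsTy; rw [wt_delta]
      have : 2 ≤ Fintype.card A := by
        rw [hs, wt_delta] at hl; omega
      omega
    omega

/-! ## §3 Values of the weights on the normal residual labels -/

omit [AddCommGroup A] [DecidableEq A] in
/-- `0` is low. [folklore] -/
theorem isLow_zero : (wt A (0 : Ty A) ≤ Fintype.card A / 2) := by rw [wt_zero]; exact Nat.zero_le _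

omit [AddCommGroup A] [DecidableEq A] in
/-- `1` is not low (`|A| ≥ 1`). [folklore] -/
theorem not_isLow_one (h1 : 1 ≤ Fintype.card A) : ¬ (wt A (1 : Ty A) ≤ Fintype.card A / 2) := by
  have : wt A (1 : Ty A) = Fintype.card A := by
    have := wt_add_one A (0 : Ty A); rw [zero_add, wt_zero] at this; omega
  rw [this]; omega

omit [AddCommGroup A] in
/-- A unit type is low (`|A| ≥ 2`). [folklore] -/
theorem isLow_delta (h2 : 2 ≤ Fintype.card A) (s : A) : (wt A (δ A s) ≤ Fintype.card A / 2) := by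
  rw [wt_delta]; omega

omit [AddCommGroup A] in
/-- The conjugate of a unit type is not low (`|A| ≥ 3`). [folklore] -/
theorem not_isLow_one_add_delta (h3 : 3 ≤ Fintype.card A) (s : A) : ¬ (wt A (1 + δ A s) ≤ Fintype.card A / 2) := by
  rw [add_comm, wt_add_one, wt_delta]; omega

omit [AddCommGroup A] [Fintype A] [DecidableEq A] in
/-- `dft s 0 = 0`. [folklore] -/
theorem dft_zero (s : A) : dft A s (0 : Ty A) = 0 := by simp [dft]

omit [AddCommGroup A] [Fintype A] [DecidableEq A] in
/-- `dft s 1 = 1`. [folklore] -/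
theorem dft_one (s : A) : dft A s (1 : Ty A) = 1 := by simp [dft]

omit [AddCommGroup A] [Fintype A] in
/-- `dft s (δ t) = [t = s]`. [folklore] -/
theorem dft_delta (s t : A) : dft A s (δ A t) = if t = s then 1 else 0 := by
  unfold dft; rw [delta_apply]
  by_cases h : t = s
  · subst h; simp
  · simp [h, Ne.symm h]

omit [AddCommGroup A] [Fintype A] in
/-- `dft s (1 + δ t) = [t ≠ s]`. [folklore] -/
theorem dft_one_add_delta (s t : A) : dft A s (1 + δ A t) = if t = s then 0 else 1 := by
  unfold dft; rw [Pi.add_apply, Pi.one_apply, delta_apply]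
  have h11 : ¬ ((1 : ZMod 2) + 1 = 1) := by decide
  by_cases h : t = s
  · subst h; simp [h11]
  · simp [h, Ne.symm h]

omit [AddCommGroup A] in
/-- The weight `uwt s` on the normal labels: only `(0, 1 + δ s)` carries it (`|A| ≥ 3`). [folklore] -/
theorem uwt_normal (h3 : 3 ≤ Fintype.card A) (s : A) {Ψ : Ty₂ A} (hp : pot A Ψ ≤ 1) (hl : (wt A Ψ.1 ≤ Fintype.card A / 2)) :
    uwt A s Ψ = if Ψ = (0, 1 + δ A s) then 1 else 0 := by
  obtain ⟨a, b⟩ := Ψ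
  have d0 := dft_zero A s
  have d1 := dft_one A s
  have d1δ := dft_one_add_delta A s
  have l0 : lowI A (0 : Ty A) = 1 := by simp [lowI, isLow_zero]
  have l1 : lowI A (1 : Ty A) = 0 := by simp [lowI, not_isLow_one A (by omega)]
  have lδ : ∀ t, lowI A (δ A t) = 1 := fun t => by simp [lowI, isLow_delta A (by omega)]
  have l1δ : ∀ t, lowI A (1 + δ A t) = 0 := fun t => by simp [lowI, not_isLow_one_add_delta A h3]
  have hne : ∀ t, (1 : Ty A) + δ A t ≠ 0 := fun t h => not_isLow_one_add_delta A h3 t (h ▸ isLow_zero A)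
  rcases normal_cases A hp hl with ⟨ha, hb⟩ | ⟨s', ha, hb⟩ <;> simp only at ha hb
  · subst ha
    rcases hb with rfl | rfl | ⟨t, rfl | rfl⟩
    · rw [if_neg (fun h => hne s (Prod.mk.inj h).2.symm)]; simp [uwt, l0, d0]
    · rw [if_neg (fun h => by
        have h' : (1 : Ty A) + δ A s = 1 + 0 := by rw [add_zero]; exact ((Prod.mk.inj h).2).symm
        exact delta_ne_zero A s (add_left_cancel h'))]
      simp [uwt, l0, l1, d1]
    · rw [if_neg (fun h => by
        have := congrArg (wt A) (Prod.mk.inj h).2; rw [add_comm (1 : Ty A), wt_add_one, wt_delta, wt_delta] at this; omega)]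
      simp [uwt, l0, lδ]
    · by_cases hts : t = s
      · subst hts; rw [if_pos rfl]; simp [uwt, l0, l1δ, d1δ]
      · rw [if_neg (fun h => hts ?_)]
        · simp [uwt, l0, l1δ, d1δ, hts]
        · have := (Prod.mk.inj h).2
          have := add_left_cancel this
          exact delta_inj A this
  · subst ha
    have hne' : ∀ e : Ty A, ((δ A s', e) : Ty₂ A) ≠ (0, 1 + δ A s) := fun e h => delta_ne_zero A s' (Prod.mk.inj h).1
    rw [if_neg (hne' b)]
    rcases hb with rfl | rfl
    · simp [uwt, lδ, l0, d0]
    · simp [uwt, lδ, l1, d1]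

/-- The mirror weight on the normal labels: only `(δ s, 1)` carries it, with value `−1` (`|A| ≥ 3`). [folklore] -/
theorem uwt'_normal (h3 : 3 ≤ Fintype.card A) (s : A) {Ψ : Ty₂ A} (hp : pot A Ψ ≤ 1) (hl : (wt A Ψ.1 ≤ Fintype.card A / 2)) :
    uwt A s (Ψ.2, Ψ.1) = if Ψ = (δ A s, 1) then -1 else 0 := by
  obtain ⟨a, b⟩ := Ψ
  have d0 := dft_zero A s
  have dδ := dft_delta A s
  have l0 : lowI A (0 : Ty A) = 1 := by simp [lowI, isLow_zero]
  have l1 : lowI A (1 : Ty A) = 0 := by simp [lowI, not_isLow_one A (by omega)]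
  have lδ : ∀ t, lowI A (δ A t) = 1 := fun t => by simp [lowI, isLow_delta A (by omega)]
  rcases normal_cases A hp hl with ⟨ha, hb⟩ | ⟨s', ha, hb⟩ <;> simp only at ha hb
  · subst ha
    rw [if_neg (fun h => delta_ne_zero A s (Prod.mk.inj h).1.symm)]
    simp [uwt, l0, d0]
  · subst ha
    rcases hb with rfl | rfl
    · rw [if_neg (fun h => by have := (Prod.mk.inj h).2; exact one_ne_zero this.symm)]
      simp [uwt, l0, lδ]
    · by_cases hs : s' = s
      · subst hs; rw [if_pos rfl]; simp [uwt, l1, lδ, dδ]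
      · rw [if_neg (fun h => hs (delta_inj A (Prod.mk.inj h).1))]
        simp [uwt, l1, lδ, dδ, hs]

/-! ## §4 The key lemma -/

omit [AddCommGroup A] in
/-- A vector supported on a set of labels is the sum of its multiples of unit vectors. [folklore] -/
theorem eq_sum_single (r : Ty₂ A → ℤ) : r = ∑ Ψ : Ty₂ A, r Ψ • (Pi.single Ψ (1 : ℤ) : Ty₂ A → ℤ) := by
  funext χ
  rw [Finset.sum_apply]
  simp only [Pi.smul_apply, Pi.single_apply, smul_eq_mul, mul_ite, mul_one, mul_zero]
  rw [Finset.sum_ite_eq]; simp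

omit [AddCommGroup A] in
/-- `U s` of a vector on the normal residual labels reads the coefficient of `(0, 1 + δ s)`. [folklore] -/
theorem U_residual (h3 : 3 ≤ Fintype.card A) (s : A) {r : Ty₂ A → ℤ} (hp : ∀ Ψ, r Ψ ≠ 0 → pot A Ψ ≤ 1)
    (hl : ∀ Ψ, r Ψ ≠ 0 → (wt A Ψ.1 ≤ Fintype.card A / 2)) : U A s r = r (0, 1 + δ A s) := by
  have h := congrArg (U A s) (eq_sum_single A r)
  rw [h, map_sum]
  simp only [map_zsmul, U_single, mul_one, smul_eq_mul]
  rw [Finset.sum_eq_single (0, 1 + δ A s)]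
  · by_cases hz : r (0, 1 + δ A s) = 0
    · rw [hz]; ring
    · rw [uwt_normal A h3 s (hp _ hz) (hl _ hz), if_pos rfl]; ring
  · intro Ψ _ hne
    by_cases hz : r Ψ = 0
    · rw [hz]; ring
    · rw [uwt_normal A h3 s (hp Ψ hz) (hl Ψ hz), if_neg hne]; ring
  · intro h; exact absurd (Finset.mem_univ _) h

/-- `U' s` of a vector on the normal residual labels reads minus the coefficient of `(δ s, 1)`. [folklore] -/
theorem U'_residual (h3 : 3 ≤ Fintype.card A) (s : A) {r : Ty₂ A → ℤ} (hp : ∀ Ψ, r Ψ ≠ 0 → pot A Ψ ≤ 1)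
    (hl : ∀ Ψ, r Ψ ≠ 0 → (wt A Ψ.1 ≤ Fintype.card A / 2)) : U' A s r = -r (δ A s, 1) := by
  have h := congrArg (U' A s) (eq_sum_single A r)
  rw [h, map_sum]
  simp only [map_zsmul, U'_single, mul_one, smul_eq_mul]
  rw [Finset.sum_eq_single (δ A s, 1)]
  · by_cases hz : r (δ A s, 1) = 0
    · rw [hz]; ring
    · rw [uwt'_normal A h3 s (hp _ hz) (hl _ hz), if_pos rfl]; ring
  · intro Ψ _ hne
    by_cases hz : r Ψ = 0
    · rw [hz]; ring
    · rw [uwt'_normal A h3 s (hp Ψ hz) (hl Ψ hz), if_neg hne]; ring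
  · intro h; exact absurd (Finset.mem_univ _) h

end Summit.HodgeConjecture.CorCM.Census.DicyclicTwist
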